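import Summits.Ventures.PercRepro.RankLevelSetRuleQSliceMapsAllC
import Summits.Ventures.PercRepro.RankLevelSetRuleQStaircaseMapsC
import Summits.Ventures.PercRepro.RankLevelSetRuleQTenWhole

/-!
# PercRepro — THE COMPLETE SLICE MAP OF RULE Q EXTENDED TO THE FAMILY `k = 10` (night-1, gen 20; dossier §30.6 / §31)

With p4 g25's whole-regime theorem `rhat_ten_whole` (`m + 9 ≤ q`) and the thin-slice map `rhat_ten_slice_iff` (`u ≤ 10`,
RankLevelSetRuleQStaircaseMapsC) the slice map of the family `k = 10` loses its bound on the slice, and the complete map of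
RankLevelSetRuleQSliceMapsAllC (`k ≤ 9`) extends:
* **`rhat_ten_slice_iff_all`** — a slice `u` of the family `k = 10` is paid on EVERY cell `(q+10, q)` iff `u ∉ {2, …, 7}`;
* **`rhat_slice_iff_all_ten`** (`5 ≤ k ≤ 10`: iff `u ∉ [2, k − 3]`), **`rhat_slice_iff_le_ten`** (`2 ≤ k ≤ 10`: iff
  `k ≤ 4 ∨ u < 2 ∨ k − 2 ≤ u`), **`ruleQ_slice_iff_le_ten`** (the matroid level).
(The «only if» half holds for EVERY `k ≥ 5`: `rhat_slice_only_if` / `ruleQ_slice_only_if`, RankLevelSetRuleQSliceNegAll.)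
Axioms: standard.
-/

namespace PercRepro

open Set Matroid

/-- **The family `k = 10`, every slice**: paid on EVERY cell `(q+10, q)` iff `u ∉ {2, …, 7}`. -/
theorem rhat_ten_slice_iff_all (u : ℕ) :
    (∀ q, u ≤ q → phiK (q + 10) q ≤ rhat q 10 (q - u)) ↔ (u ≠ 2 ∧ u ≠ 3 ∧ u ≠ 4 ∧ u ≠ 5 ∧ u ≠ 6 ∧ u ≠ 7) := by
  constructor
  · intro h
    refine ⟨fun hu2 => ?_, fun hu3 => ?_, fun hu4 => ?_, fun hu5 => ?_, fun hu6 => ?_, fun hu7 => ?_⟩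
    · subst hu2; exact ((rhat_ten_slice_iff 2 (by norm_num)).1 h).1 rfl
    · subst hu3; exact ((rhat_ten_slice_iff 3 (by norm_num)).1 h).2.1 rfl
    · subst hu4; exact ((rhat_ten_slice_iff 4 (by norm_num)).1 h).2.2.1 rfl
    · subst hu5; exact ((rhat_ten_slice_iff 5 (by norm_num)).1 h).2.2.2.1 rfl
    · subst hu6; exact ((rhat_ten_slice_iff 6 (by norm_num)).1 h).2.2.2.2.1 rfl
    · subst hu7; exact ((rhat_ten_slice_iff 7 (by norm_num)).1 h).2.2.2.2.2 rfl
  · rintro ⟨hu2, hu3, hu4, hu5, hu6, hu7⟩ q hq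
    rcases Nat.lt_or_ge u 9 with hlt | hge
    · exact (rhat_ten_slice_iff u (by omega)).2 ⟨hu2, hu3, hu4, hu5, hu6, hu7⟩ q hq
    · exact rhat_ten_whole q (q - u) (by omega)

/-- **THE SLICE MAP OF THE FAMILIES `5 ≤ k ≤ 10`, COMPLETE AND EXACT**: the slice `u = q − #P` is paid on EVERY cell `(q+k, q)`
iff `u ∉ [2, k − 3]`. -/
theorem rhat_slice_iff_all_ten (k u : ℕ) (hk5 : 5 ≤ k) (hk10 : k ≤ 10) :
    (∀ q, u ≤ q → phiK (q + k) q ≤ rhat q k (q - u)) ↔ (u < 2 ∨ k - 2 ≤ u) := by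
  rcases Nat.lt_or_ge k 10 with hlt | hge
  · exact rhat_slice_iff_all_nine k u hk5 (by omega)
  · obtain rfl : k = 10 := by omega
    rw [rhat_ten_slice_iff_all u]; omega

/-- **THE SLICE MAP OF RULE Q ON EVERY FAMILY `2 ≤ k ≤ 10`**: paid on every cell iff `k ≤ 4`, or `u ≤ 1`, or `u ≥ k − 2`. -/
theorem rhat_slice_iff_le_ten (k u : ℕ) (hk2 : 2 ≤ k) (hk10 : k ≤ 10) :
    (∀ q, u ≤ q → phiK (q + k) q ≤ rhat q k (q - u)) ↔ (k ≤ 4 ∨ u < 2 ∨ k - 2 ≤ u) := by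
  rcases Nat.lt_or_ge k 10 with hlt | hge
  · exact rhat_slice_iff_le_nine k u hk2 (by omega)
  · obtain rfl : k = 10 := by omega
    rw [rhat_ten_slice_iff_all u]; omega

/-- **THE SLICE MAP AT THE MATROID LEVEL FOR EVERY FAMILY `2 ≤ k ≤ 10`**. -/
theorem ruleQ_slice_iff_le_ten (k u : ℕ) (hk2 : 2 ≤ k) (hk10 : k ≤ 10) :
    (∀ (β : Type) (M : Matroid β) (hf : M.Finite) (q : ℕ), u ≤ q → M.E.ncard = (q + k) + q →
        ∀ Z ∈ cellMembers M (q + k) q, (flatPart M Z).ncard = q - u →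
          phiK (q + k) q ≤ @ruleQRecv β M hf (q + k) q Z)
      ↔ (k ≤ 4 ∨ u < 2 ∨ k - 2 ≤ u) := by
  constructor
  · intro h
    by_contra hu
    have h' := (rhat_slice_iff_le_ten k u hk2 hk10).not.2 hu
    push Not at h'
    obtain ⟨q, hq, hlt⟩ := h'
    obtain ⟨β, M, hf, Z, hE, hZ, hP, hrecv⟩ := modelRecvEq_flatPart q k (q - u) hk2 (Nat.sub_le q u)
    have h1 := h β M hf q hq hE Z hZ hP
    rw [hrecv] at h1
    exact absurd h1 (not_le.mpr hlt)
  · intro hu β M hf q hq hE Z hZ hP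
    have h1 := (rhat_slice_iff_le_ten k u hk2 hk10).2 hu q hq
    have h2 := @rhat_le_ruleQRecv β M hf q k hE Z hZ
    rw [hP] at h2
    exact h1.trans h2

end PercRepro
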